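import Mathlib
import Summits.Ventures.PercRepro2.TypedPendantA3AtRootRow
import Summits.Ventures.PercRepro2.TypedPendantA3AtOWeighted

/-!
# The pendant `a₃` at a root, weighted: `Gc(p) = (1 − t)·((1 − t)·Gc(p[f:=0]) + t·P(Q)·B)` (blind
cell PercRepro2, mine-2 g54, 2026-08-29; `conjectures/MINE-2.md` M2-115 add. 1)

The typed row `(N₀, N₀ + C, C, 0)` of a pendant `a₃` at a root (`TypedPendantA3AtRoot.lean`,
`TypedPendantA3AtRootRow.lean`) lifts to every weight vector through p1's pinning recursion, as
the rule at `o` did (`TypedPendantA3AtOWeighted.lean`): for `f = {a₃, a₂}` and `f ∉ F`,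

  **`triSum_pendant_a3_at_a2`**:
  `triSum p F τ K₃ = (1 − t)·((1 − t)·triSum p₀ F τ K₃ + t·triSum p₀ F τ (1_Q(x)·Cov_{y,w}(1_{o∈C(a₁)}, σ_b)))`

with `t = p f` and `p₀ = p[f := 0]` (the Bernstein weights `(1 − t)³, t(1 − t)², t²(1 − t)` on
`N₀, N₀ + C, C` sum to `(1 − t)((1 − t) N₀ + t C)`); the mirror at `a₁`
(`triSum_pendant_a3_at_a1`).  With `F = ∅` the spectator factor splits off
(`triSum_empty_spec_mul`): **`Gc_pendant_a3_at_a2`**: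
`Gc p = (1 − t)·((1 − t)·Gc p₀ + t·E_{p₀}[1_Q]·B_{p₀}(Cov(1_{o∈C(a₁)}, σ_b)))`, `B` the bilinear
form of the two-copy covariance kernel — the weighted row «`a₃` at `a₂`:
`2(1−t)P[t·SS + (1−t)Z_H + Z_L]`» of `conjectures/MINE-2-RULES.md` (Thm 22, there on `K₅`) on
every finite graph: (HCOV) at a pendant `a₃` at a root is (HCOV) with the leaf removed plus the
`Q`-conditioned covariance of `1_{o∈C(a₁)}` with `σ_b`, each with a nonnegative weight.  Own work;
standard axioms.
-/

namespace Summit.Ventures.PercRepro2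

namespace CovForm

namespace TypedRed

open OneTyped

section Weighted

open Classical

variable {V : Type*} {E : Type*} [Fintype E] [DecidableEq E] {R : Type*} [Field R]
variable (ends : E → Sym2 V) (o a₁ a₂ a₃ b : V)

/-- **The base case at `a₂`**: every free edge other than `f` pinned. -/
lemma triSum_pendant_a3_at_a2_pinned {f : E} (hf : ends f = s(a₃, a₂))
    (hleaf : ∀ e, a₃ ∈ ends e → e = f) (h32 : a₃ ≠ a₂) (h3o : a₃ ≠ o) (h31 : a₃ ≠ a₁)
    (h3b : a₃ ≠ b) (p : E → R) (F : Finset E) (hfF : f ∉ F)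
    (hq : ∀ e, e ∉ insert f F → p e = 0 ∨ p e = 1) (τ : E → ℕ) :
    triSum p F τ (K3 ends o a₁ a₂ a₃ b : Config E → Config E → Config E → R) =
      (1 - p f) * ((1 - p f) * triSum (Function.update p f 0) F τ (K3 ends o a₁ a₂ a₃ b) +
        p f * triSum (Function.update p f 0) F τ (fun x y w =>
          iQ ends a₁ a₂ x * TypedA3.covKer ends a₁ a₂ (iL ends a₁ o) (sigma ends a₁ a₂ b) y w)) := by
  have hfF' : f ∈ insert f F := Finset.mem_insert_self f F
  have hne : ∀ e ∈ F, e ≠ f := fun e he => ne_of_mem_of_not_mem he hfF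
  have hq0 : ∀ e, e ∉ F → Function.update p f 0 e = 0 ∨ Function.update p f 0 e = 1 := by
    intro e he
    by_cases h : e = f
    · subst h; left; simp
    · rw [Function.update_of_ne h]
      exact hq e (by simp [he, h])
  have hq1 : ∀ e, e ∉ F → Function.update p f 1 e = 0 ∨ Function.update p f 1 e = 1 := by
    intro e he
    by_cases h : e = f
    · subst h; right; simp
    · rw [Function.update_of_ne h]
      exact hq e (by simp [he, h])
  set P0 : R := ∏ e ∈ F, p e ^ τ e * (1 - p e) ^ (3 - τ e) with hP0
  have hprod : ∀ k : ℕ, (∏ e ∈ F, p e ^ Function.update τ f k e *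
      (1 - p e) ^ (3 - Function.update τ f k e)) = P0 := fun k =>
    Finset.prod_congr rfl fun e he => by rw [Function.update_of_ne (hne e he)]
  have hprod0 : (∏ e ∈ F, Function.update p f 0 e ^ τ e *
      (1 - Function.update p f 0 e) ^ (3 - τ e)) = P0 :=
    Finset.prod_congr rfl fun e he => by rw [Function.update_of_ne (hne e he)]
  have hprod1 : (∏ e ∈ F, Function.update p f 1 e ^ τ e *
      (1 - Function.update p f 1 e) ^ (3 - τ e)) = P0 :=
    Finset.prod_congr rfl fun e he => by rw [Function.update_of_ne (hne e he)]
  set Kc : Config E → Config E → Config E → R := fun x y w =>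
    iQ ends a₁ a₂ x * TypedA3.covKer ends a₁ a₂ (iL ends a₁ o) (sigma ends a₁ a₂ b) y w with hKc
  set T₀ : R := typedCount F (Function.update (pinnedConfig p) f false) τ
    (K3 ends o a₁ a₂ a₃ b) with hT₀
  set C₀ : R := typedCount F (Function.update (pinnedConfig p) f false) τ Kc with hC₀
  have hT0 : typedCount (insert f F) (pinnedConfig p) (Function.update τ f 0)
      (K3 ends o a₁ a₂ a₃ b : Config E → Config E → Config E → R) = T₀ := by
    rw [typedCount_type_zero (insert f F) f hfF' _ _ (Function.update_self f 0 τ),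
      Finset.erase_insert hfF, hT₀]
    exact typedCount_congr_τ _ _ (fun e he => Function.update_of_ne (hne e he) _ _) _
  have hC0 : typedCount (insert f F) (pinnedConfig p) (Function.update τ f 0) Kc = C₀ := by
    rw [typedCount_type_zero (insert f F) f hfF' _ _ (Function.update_self f 0 τ),
      Finset.erase_insert hfF, hC₀]
    exact typedCount_congr_τ _ _ (fun e he => Function.update_of_ne (hne e he) _ _) _
  have hT3 : typedCount F (Function.update (pinnedConfig p) f true) τ
      (K3 ends o a₁ a₂ a₃ b : Config E → Config E → Config E → R) = 0 := by
    have h := typedCount_type_three (insert f F) f hfF' (pinnedConfig p) (Function.update τ f 3)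
      (Function.update_self f 3 τ) (K3 ends o a₁ a₂ a₃ b : Config E → Config E → Config E → R)
    rw [Finset.erase_insert hfF,
      typedCount_congr_τ F _ (fun e he => Function.update_of_ne (hne e he) _ _) _] at h
    rw [← h, typedCount_pendant_a3_at_a2_three ends o a₁ a₂ a₃ b hf (insert f F) hfF'
      (pinnedConfig p) τ]
  have hT2 := typedCount_pendant_a3_at_a2 (R := R) ends o a₁ a₂ a₃ b hf hleaf h32 h3o h31 h3b
    (insert f F) hfF' (pinnedConfig p) τ
  have hT1 := typedCount_pendant_a3_at_a2_one (R := R) ends o a₁ a₂ a₃ b hf hleaf h32 h3o h31 h3b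
    (insert f F) hfF' (pinnedConfig p) τ
  rw [← hKc, hC0] at hT2
  rw [hT0, hT2] at hT1
  rw [triSum_pin p hfF τ, triSum_pinned_eq p (insert f F) hq, triSum_pinned_eq p (insert f F) hq,
    triSum_pinned_eq _ F hq0, triSum_pinned_eq _ F hq1, triSum_pinned_eq _ F hq0,
    Finset.prod_insert hfF, Finset.prod_insert hfF, hprod, hprod, hprod0, hprod1,
    pinnedConfig_update_zero, pinnedConfig_update_one, hT1, hT2, hT3, ← hT₀, ← hC₀,
    Function.update_self, Function.update_self]
  ring

/-- **The weighted pendant `a₃` at `a₂`**: for a typed edge set `F` not containing the leaf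
edge `f = {a₃, a₂}`, every typed three-copy sum of `K₃` is
`(1 − t)·((1 − t)·M₀ + t·C)` with `t = p f`, `M₀` the sum with `f` pinned closed and `C` the sum,
with `f` pinned closed, of the `Q`-weighted two-copy covariance of `1_{o∈C(a₁)}` with `σ_b`. -/
theorem triSum_pendant_a3_at_a2 {f : E} (hf : ends f = s(a₃, a₂))
    (hleaf : ∀ e, a₃ ∈ ends e → e = f) (h32 : a₃ ≠ a₂) (h3o : a₃ ≠ o) (h31 : a₃ ≠ a₁)
    (h3b : a₃ ≠ b) (p : E → R) (F : Finset E) (hfF : f ∉ F) (τ : E → ℕ) :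
    triSum p F τ (K3 ends o a₁ a₂ a₃ b : Config E → Config E → Config E → R) =
      (1 - p f) * ((1 - p f) * triSum (Function.update p f 0) F τ (K3 ends o a₁ a₂ a₃ b) +
        p f * triSum (Function.update p f 0) F τ (fun x y w =>
          iQ ends a₁ a₂ x * TypedA3.covKer ends a₁ a₂ (iL ends a₁ o) (sigma ends a₁ a₂ b) y w)) := by
  generalize hn : (triFracFree p (insert f F)).card = n
  induction n using Nat.strong_induction_on generalizing p F τ with
  | _ n ih =>
    by_cases h0 : triFracFree p (insert f F) = ∅
    · apply triSum_pendant_a3_at_a2_pinned ends o a₁ a₂ a₃ b hf hleaf h32 h3o h31 h3b p F hfF _ τ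
      intro e he
      by_contra hc
      rw [not_or] at hc
      have : e ∈ triFracFree p (insert f F) := mem_triFracFree.mpr ⟨he, hc.1, hc.2⟩
      rw [h0] at this
      exact absurd this (Finset.notMem_empty e)
    · obtain ⟨e, he⟩ := Finset.nonempty_iff_ne_empty.mpr h0
      have heF : e ∉ insert f F := (mem_triFracFree.mp he).1
      have hef : e ≠ f := fun h => heF (h ▸ Finset.mem_insert_self f F)
      have heF' : e ∉ F := fun h => heF (Finset.mem_insert_of_mem h)
      have hfF' : f ∉ insert e F := by
        rw [Finset.mem_insert, not_or]
        exact ⟨hef.symm, hfF⟩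
      have hlt : ((triFracFree p (insert f F)).erase e).card < n := by
        rw [← hn]
        exact Finset.card_erase_lt_of_mem he
      have hc0 : (triFracFree (Function.update p e 0) (insert f F)).card =
          ((triFracFree p (insert f F)).erase e).card := by
        rw [triFracFree_update p (insert f F) e 0 (Or.inl rfl)]
      have hc1 : (triFracFree (Function.update p e 1) (insert f F)).card =
          ((triFracFree p (insert f F)).erase e).card := by
        rw [triFracFree_update p (insert f F) e 1 (Or.inr rfl)]
      have hc2 : (triFracFree p (insert f (insert e F))).card =
          ((triFracFree p (insert f F)).erase e).card := by
        rw [Finset.insert_comm, triFracFree_insert]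
      have h1 := ih _ hlt (Function.update p e 0) F hfF τ hc0
      have h2 := ih _ hlt (Function.update p e 1) F hfF τ hc1
      have h3 := ih _ hlt p (insert e F) hfF' (Function.update τ e 1) hc2
      have h4 := ih _ hlt p (insert e F) hfF' (Function.update τ e 2) hc2
      rw [triSum_pin p heF' τ, triSum_pin (Function.update p f 0) heF' τ,
        triSum_pin (Function.update p f 0) heF' τ, h1, h2, h3, h4,
        Function.update_of_ne hef.symm, Function.update_of_ne hef.symm, Function.update_of_ne hef,
        Function.update_comm hef, Function.update_comm hef]
      ring

/-- **The base case at `a₁`** (the mirror). -/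
lemma triSum_pendant_a3_at_a1_pinned {f : E} (hf : ends f = s(a₃, a₁))
    (hleaf : ∀ e, a₃ ∈ ends e → e = f) (h31 : a₃ ≠ a₁) (h3o : a₃ ≠ o) (h32 : a₃ ≠ a₂)
    (h3b : a₃ ≠ b) (p : E → R) (F : Finset E) (hfF : f ∉ F)
    (hq : ∀ e, e ∉ insert f F → p e = 0 ∨ p e = 1) (τ : E → ℕ) :
    triSum p F τ (K3 ends o a₁ a₂ a₃ b : Config E → Config E → Config E → R) =
      (1 - p f) * ((1 - p f) * triSum (Function.update p f 0) F τ (K3 ends o a₁ a₂ a₃ b) +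
        p f * triSum (Function.update p f 0) F τ (fun x y w =>
          iQ ends a₁ a₂ x * TypedA3.covKer ends a₁ a₂ (iH ends a₂ o) (sigma ends a₂ a₁ b) y w)) := by
  have hfF' : f ∈ insert f F := Finset.mem_insert_self f F
  have hne : ∀ e ∈ F, e ≠ f := fun e he => ne_of_mem_of_not_mem he hfF
  have hq0 : ∀ e, e ∉ F → Function.update p f 0 e = 0 ∨ Function.update p f 0 e = 1 := by
    intro e he
    by_cases h : e = f
    · subst h; left; simp
    · rw [Function.update_of_ne h]
      exact hq e (by simp [he, h])
  have hq1 : ∀ e, e ∉ F → Function.update p f 1 e = 0 ∨ Function.update p f 1 e = 1 := by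
    intro e he
    by_cases h : e = f
    · subst h; right; simp
    · rw [Function.update_of_ne h]
      exact hq e (by simp [he, h])
  set P0 : R := ∏ e ∈ F, p e ^ τ e * (1 - p e) ^ (3 - τ e) with hP0
  have hprod : ∀ k : ℕ, (∏ e ∈ F, p e ^ Function.update τ f k e *
      (1 - p e) ^ (3 - Function.update τ f k e)) = P0 := fun k =>
    Finset.prod_congr rfl fun e he => by rw [Function.update_of_ne (hne e he)]
  have hprod0 : (∏ e ∈ F, Function.update p f 0 e ^ τ e *
      (1 - Function.update p f 0 e) ^ (3 - τ e)) = P0 :=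
    Finset.prod_congr rfl fun e he => by rw [Function.update_of_ne (hne e he)]
  have hprod1 : (∏ e ∈ F, Function.update p f 1 e ^ τ e *
      (1 - Function.update p f 1 e) ^ (3 - τ e)) = P0 :=
    Finset.prod_congr rfl fun e he => by rw [Function.update_of_ne (hne e he)]
  set Kc : Config E → Config E → Config E → R := fun x y w =>
    iQ ends a₁ a₂ x * TypedA3.covKer ends a₁ a₂ (iH ends a₂ o) (sigma ends a₂ a₁ b) y w with hKc
  set T₀ : R := typedCount F (Function.update (pinnedConfig p) f false) τ
    (K3 ends o a₁ a₂ a₃ b) with hT₀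
  set C₀ : R := typedCount F (Function.update (pinnedConfig p) f false) τ Kc with hC₀
  have hT0 : typedCount (insert f F) (pinnedConfig p) (Function.update τ f 0)
      (K3 ends o a₁ a₂ a₃ b : Config E → Config E → Config E → R) = T₀ := by
    rw [typedCount_type_zero (insert f F) f hfF' _ _ (Function.update_self f 0 τ),
      Finset.erase_insert hfF, hT₀]
    exact typedCount_congr_τ _ _ (fun e he => Function.update_of_ne (hne e he) _ _) _
  have hC0 : typedCount (insert f F) (pinnedConfig p) (Function.update τ f 0) Kc = C₀ := by
    rw [typedCount_type_zero (insert f F) f hfF' _ _ (Function.update_self f 0 τ),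
      Finset.erase_insert hfF, hC₀]
    exact typedCount_congr_τ _ _ (fun e he => Function.update_of_ne (hne e he) _ _) _
  have hT3 : typedCount F (Function.update (pinnedConfig p) f true) τ
      (K3 ends o a₁ a₂ a₃ b : Config E → Config E → Config E → R) = 0 := by
    have h := typedCount_type_three (insert f F) f hfF' (pinnedConfig p) (Function.update τ f 3)
      (Function.update_self f 3 τ) (K3 ends o a₁ a₂ a₃ b : Config E → Config E → Config E → R)
    rw [Finset.erase_insert hfF,
      typedCount_congr_τ F _ (fun e he => Function.update_of_ne (hne e he) _ _) _] at h
    rw [← h, typedCount_pendant_a3_at_a1_three ends o a₁ a₂ a₃ b hf (insert f F) hfF'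
      (pinnedConfig p) τ]
  have hT2 := typedCount_pendant_a3_at_a1 (R := R) ends o a₁ a₂ a₃ b hf hleaf h31 h3o h32 h3b
    (insert f F) hfF' (pinnedConfig p) τ
  have hT1 := typedCount_pendant_a3_at_a1_one (R := R) ends o a₁ a₂ a₃ b hf hleaf h31 h3o h32 h3b
    (insert f F) hfF' (pinnedConfig p) τ
  rw [← hKc, hC0] at hT2
  rw [hT0, hT2] at hT1
  rw [triSum_pin p hfF τ, triSum_pinned_eq p (insert f F) hq, triSum_pinned_eq p (insert f F) hq,
    triSum_pinned_eq _ F hq0, triSum_pinned_eq _ F hq1, triSum_pinned_eq _ F hq0,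
    Finset.prod_insert hfF, Finset.prod_insert hfF, hprod, hprod, hprod0, hprod1,
    pinnedConfig_update_zero, pinnedConfig_update_one, hT1, hT2, hT3, ← hT₀, ← hC₀,
    Function.update_self, Function.update_self]
  ring

/-- **The weighted pendant `a₃` at `a₁`** (the mirror). -/
theorem triSum_pendant_a3_at_a1 {f : E} (hf : ends f = s(a₃, a₁))
    (hleaf : ∀ e, a₃ ∈ ends e → e = f) (h31 : a₃ ≠ a₁) (h3o : a₃ ≠ o) (h32 : a₃ ≠ a₂)
    (h3b : a₃ ≠ b) (p : E → R) (F : Finset E) (hfF : f ∉ F) (τ : E → ℕ) :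
    triSum p F τ (K3 ends o a₁ a₂ a₃ b : Config E → Config E → Config E → R) =
      (1 - p f) * ((1 - p f) * triSum (Function.update p f 0) F τ (K3 ends o a₁ a₂ a₃ b) +
        p f * triSum (Function.update p f 0) F τ (fun x y w =>
          iQ ends a₁ a₂ x * TypedA3.covKer ends a₁ a₂ (iH ends a₂ o) (sigma ends a₂ a₁ b) y w)) := by
  generalize hn : (triFracFree p (insert f F)).card = n
  induction n using Nat.strong_induction_on generalizing p F τ with
  | _ n ih =>
    by_cases h0 : triFracFree p (insert f F) = ∅
    · apply triSum_pendant_a3_at_a1_pinned ends o a₁ a₂ a₃ b hf hleaf h31 h3o h32 h3b p F hfF _ τ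
      intro e he
      by_contra hc
      rw [not_or] at hc
      have : e ∈ triFracFree p (insert f F) := mem_triFracFree.mpr ⟨he, hc.1, hc.2⟩
      rw [h0] at this
      exact absurd this (Finset.notMem_empty e)
    · obtain ⟨e, he⟩ := Finset.nonempty_iff_ne_empty.mpr h0
      have heF : e ∉ insert f F := (mem_triFracFree.mp he).1
      have hef : e ≠ f := fun h => heF (h ▸ Finset.mem_insert_self f F)
      have heF' : e ∉ F := fun h => heF (Finset.mem_insert_of_mem h)
      have hfF' : f ∉ insert e F := by
        rw [Finset.mem_insert, not_or]
        exact ⟨hef.symm, hfF⟩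
      have hlt : ((triFracFree p (insert f F)).erase e).card < n := by
        rw [← hn]
        exact Finset.card_erase_lt_of_mem he
      have hc0 : (triFracFree (Function.update p e 0) (insert f F)).card =
          ((triFracFree p (insert f F)).erase e).card := by
        rw [triFracFree_update p (insert f F) e 0 (Or.inl rfl)]
      have hc1 : (triFracFree (Function.update p e 1) (insert f F)).card =
          ((triFracFree p (insert f F)).erase e).card := by
        rw [triFracFree_update p (insert f F) e 1 (Or.inr rfl)]
      have hc2 : (triFracFree p (insert f (insert e F))).card =
          ((triFracFree p (insert f F)).erase e).card := by
        rw [Finset.insert_comm, triFracFree_insert]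
      have h1 := ih _ hlt (Function.update p e 0) F hfF τ hc0
      have h2 := ih _ hlt (Function.update p e 1) F hfF τ hc1
      have h3 := ih _ hlt p (insert e F) hfF' (Function.update τ e 1) hc2
      have h4 := ih _ hlt p (insert e F) hfF' (Function.update τ e 2) hc2
      rw [triSum_pin p heF' τ, triSum_pin (Function.update p f 0) heF' τ,
        triSum_pin (Function.update p f 0) heF' τ, h1, h2, h3, h4,
        Function.update_of_ne hef.symm, Function.update_of_ne hef.symm, Function.update_of_ne hef,
        Function.update_comm hef, Function.update_comm hef]
      ring

/-- The cubic form of a spectator-times-pair kernel is the expectation of the spectator factor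
times the bilinear form of the pair kernel. -/
lemma triSum_empty_spec_mul (p : E → R) (τ : E → ℕ) (g : Config E → R)
    (K : Config E → Config E → R) :
    triSum p ∅ τ (fun x y w => g x * K y w) = expect p g * biForm p p K := by
  rw [triSum_empty]
  unfold expect biForm
  rw [Finset.sum_mul_sum]
  refine Finset.sum_congr rfl fun x _ => ?_
  simp only [Finset.mul_sum]
  refine Finset.sum_congr rfl fun y _ => Finset.sum_congr rfl fun w _ => ?_
  ring

variable [LinearOrder R] [IsStrictOrderedRing R]

/-- **(HCOV)'s cubic form at a pendant `a₃` at `a₂`**: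
`Gc p = (1 − t)·((1 − t)·Gc p₀ + t·E_{p₀}[1_Q]·B_{p₀}(Cov(1_{o∈C(a₁)}, σ_b)))`, `t = p f`,
`p₀ = p[f := 0]`. -/
theorem Gc_pendant_a3_at_a2 {f : E} (hf : ends f = s(a₃, a₂))
    (hleaf : ∀ e, a₃ ∈ ends e → e = f) (h32 : a₃ ≠ a₂) (h3o : a₃ ≠ o) (h31 : a₃ ≠ a₁)
    (h3b : a₃ ≠ b) (p : E → R) :
    Gc p ends o a₁ a₂ a₃ b =
      (1 - p f) * ((1 - p f) * Gc (Function.update p f 0) ends o a₁ a₂ a₃ b +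
        p f * (expect (Function.update p f 0) (iQ ends a₁ a₂) *
          biForm (Function.update p f 0) (Function.update p f 0)
            (TypedA3.covKer ends a₁ a₂ (iL ends a₁ o) (sigma ends a₁ a₂ b)))) := by
  rw [hcov_cubic p ends o a₁ a₂ a₃ b (fun _ => 0),
    hcov_cubic (Function.update p f 0) ends o a₁ a₂ a₃ b (fun _ => 0),
    triSum_pendant_a3_at_a2 ends o a₁ a₂ a₃ b hf hleaf h32 h3o h31 h3b p ∅
      (Finset.notMem_empty f) (fun _ => 0), triSum_empty_spec_mul]

/-- **(HCOV)'s cubic form at a pendant `a₃` at `a₁`** (the mirror). -/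
theorem Gc_pendant_a3_at_a1 {f : E} (hf : ends f = s(a₃, a₁))
    (hleaf : ∀ e, a₃ ∈ ends e → e = f) (h31 : a₃ ≠ a₁) (h3o : a₃ ≠ o) (h32 : a₃ ≠ a₂)
    (h3b : a₃ ≠ b) (p : E → R) :
    Gc p ends o a₁ a₂ a₃ b =
      (1 - p f) * ((1 - p f) * Gc (Function.update p f 0) ends o a₁ a₂ a₃ b +
        p f * (expect (Function.update p f 0) (iQ ends a₁ a₂) *
          biForm (Function.update p f 0) (Function.update p f 0)
            (TypedA3.covKer ends a₁ a₂ (iH ends a₂ o) (sigma ends a₂ a₁ b)))) := by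
  rw [hcov_cubic p ends o a₁ a₂ a₃ b (fun _ => 0),
    hcov_cubic (Function.update p f 0) ends o a₁ a₂ a₃ b (fun _ => 0),
    triSum_pendant_a3_at_a1 ends o a₁ a₂ a₃ b hf hleaf h31 h3o h32 h3b p ∅
      (Finset.notMem_empty f) (fun _ => 0), triSum_empty_spec_mul]

end Weighted

end TypedRed

end CovForm

end Summit.Ventures.PercRepro2
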